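import Mathlib
import Literature.Analysis.ODE.VariationalEnclosureOpenDomain
import HarnessLib

/-!
# The interval (box) form of the C¹ high-order enclosure test

`VariationalEnclosureOpenDomain.lean` (anchor #28; Walawska–Wilczak 2016 §2.1, Zgliczyński 2002)
proves the `C¹` high-order enclosure (HOE) step for a field `f` smooth on an open `Ω`: given an
a-priori box `S ⊆ Ω`, a matrix box `Ṽ = [CV, DV]`, a remainder matrix box `[CN, DN]` and the two
SEMANTIC inclusions

* `hKN`:   `Φ_K'(z) ∘ M ∈ [CN, DN]` for all `z ∈ S` and all matrices `M ∈ [CV, DV]`,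
* `hinclV`: `∑_{j<K} t^j Φ_j'(x) + t^K N ∈ [CV, DV]` for `x ∈ W`, `t ∈ [0, h]`, `N ∈ [CN, DN]`,

(together with the state test of anchors #4/#18) every solution pair `(z, J)` of `z' = f(z)`,
`J' = Df(z) ∘ J`, `z(0) = x ∈ W`, `J(0) = Id` is enclosed and `∂φ(τ, x)/∂x` lies in the `C¹`
enclosure.  What a `C¹`-Lohner-type integrator actually CHECKS is the interval-arithmetic form of
these inclusions (Walawska–Wilczak 2016 §2.1, eqs. for `[Ṽ]` and `[E]`): with INTERVAL MATRICES
`EV_j ⊇ {Φ_j'(x) : x ∈ W}` (`j < K`) and `AK ⊇ {Φ_K'(z) : z ∈ S}` obtained by automatic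
differentiation in interval arithmetic, the interval matrix product `NN ⊇ AK · Ṽ`
(Neumaier 1990 §3.1, Proposition 3.1.2 (6): `(AB)_{ik} = ∑_j A_{ij} B_{jk}` with scalar interval
products) and the matrix interval Taylor polynomial `∑_{j<K} T^j · EV_j + T^K · NN ⊆ Ṽ`,
`T ⊇ [0, h]` — finitely many inequalities between computed numbers.  This file formalises that
step, in the style of `HighOrderEnclosureIntervalTest.lean` (anchor #18) for the state part.

## Contents (interval matrices are `A : ι → κ → NonemptyInterval ℝ`, row `i`, column `k`)

* `matBoxSet A = Icc (mboxLo A) (mboxHi A)` — the set of real matrices (as `ι → κ → ℝ`, the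
  entry convention `fun i j => M (Pi.single j 1) i` of `VariationalEnclosure.lean`) represented by
  `A` (Neumaier 1990 §3.1: `A = [A̲, Ā] = {Ã | A̲ ≤ Ã ≤ Ā}`); `mem_matBoxSet_iff` (entrywise);
* `imatmul A B` — the interval matrix product `(AB)_{ik} = ∑_j A_{ij} · B_{jk}` (Moore products,
  exact interval sums) with its inclusion property `matmul_mem_imatmul` (`Ã ∈ A`, `B̃ ∈ B` ⇒
  `ÃB̃ ∈ AB`) and inclusion isotonicity `imatmul_le_imatmul` (Neumaier 1990 Proposition 3.1.2
  (6), (7));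
* `hoeMatBox T EV NN K = ∑_{j<K} T^j · EV_j + T^K · NN` (row-wise the `hoeBox` of anchor #18) with
  `jacTaylorSum_mem_hoeMatBox` (inclusion property) and `hoeMatBox_le_hoeMatBox` (isotonicity);
* `comp_apply_single` — the entries of a composition of linear maps are the matrix product of the
  entries; `hKN_of_imatmul`, `hinclV_of_hoeMatBox` — the interval tests imply the semantic
  hypotheses `hKN`, `hinclV` of `variationalEnclosure_step(_local/_smoothOn_local)`, for ANY
  Jacobian data `Φ_j'`;
* `variationalEnclosure_step_intervalTest_smoothOn_local` — the `C¹` HOE step for a field `C^∞`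
  on an open `Ω` from BOX DATA ONLY: boxes `W`, `S` (`boxSet S ⊆ Ω`), `V ⊇ Φ_K(S)`,
  `E_j ⊇ Φ_j(W)`, interval matrices `EV_j ∋ Φ_j'(x)` (`x ∈ W`), `AK ∋ Φ_K'(z)` (`z ∈ S`), `Ṽ`,
  `NN ⊇ AK · Ṽ`, and the two containments `hoeBox T E V K ≤ S`, `hoeMatBox T EV NN K ≤ Ṽ`
  ⇒ existence of the variational pair from `(x, Id)` and enclosure of EVERY solution pair:
  `z t ∈ S` (+ Taylor representation), `J t ∈ Ṽ` and `J t = ∑_{j<K} t^j Φ_j'(x) + t^K N`, `N ∈ NN`,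
  entrywise; `variationalEnclosure_jacobian_tube_smoothOn_local` (`J t ∈ ∑ T^j EV_j + T^K NN`);
  `hasFDerivWithinAt_flow_intervalTest_smoothOn_local` (the derivative WITHIN `W` of any solution
  family's flow map lies in `Ṽ` and in `∑_{j<K} T'^j · EV_j + T'^K · NN` for any `T' ∋ τ`, e.g.
  `T' = [h, h]`: the matrix `J1 ∋ Dφ_h(x)` a `C¹`-Lohner step hands to its QR / parallelepiped
  stage);
* `uniqueDiffOn_boxSet` — a box with non-degenerate component intervals is a set of unique
  differentiability (so the flow derivative within it is meaningful).

Directed roundings only widen `EV_j`, `AK`, `NN`, the `hoeMatBox` (isotonicity), so passing the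
machine test implies the exact containments assumed here (Moore 1979 §3.2; Neumaier 1990 (7)).

## References

* I. Walawska, D. Wilczak, *An implicit algorithm for validated enclosures of the solutions to
  variational equations for ODEs*, Appl. Math. Comput. 291 (2016) 303–322 (arXiv:1509.07388), §2.1
  (`[Ṽ] = ∑_{i≤m} [0,h_k]^i ψ^[i](0,[x_k],Id) + [E]`, test `[0,h_k]^{m+1} ψ^[m+1](0,[ỹ],Id)[Ṽ] ⊂ [E]`),
  §2.2 Lemma 2. [WalawskaWilczak2016]
* P. Zgliczyński, *C¹ Lohner algorithm*, Found. Comput. Math. 2 (2002) 429–465. [Zgliczynski2002C1Lohner]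
* A. Neumaier, *Interval Methods for Systems of Equations*, Cambridge UP 1990, §3.1 (interval
  matrices `A = [A̲, Ā]`, `AB := □{ÃB̃}`), Proposition 3.1.2 (6) `(AB)_{ik} = ∑_j A_{ij}B_{jk}`,
  (7) inclusion isotonicity. [Neumaier1991]
* R. E. Moore, *Methods and Applications of Interval Analysis*, SIAM 1979, §2.2, §3.2 (3.4)–(3.5),
  §3.5 (3.31), §8.1 (8.10). [Moore1979]
-/

noncomputable section

open Set Metric Filter Topology TopologicalSpace NonemptyInterval

open scoped NNReal ContDiff

namespace Literature.Analysis.ODE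

/-! ### Interval matrices: represented set, product, matrix HOE box -/

section IntervalMatrix

variable {ι κ μ : Type*}

/-- The lower real matrix `A̲` of an interval matrix (Neumaier 1990 §3.1, `inf(A)`).
[cite: Neumaier1991, §3.1 (inf A, sup A)] -/
def mboxLo (A : ι → κ → NonemptyInterval ℝ) : ι → κ → ℝ := fun i => boxLo (A i)

/-- The upper real matrix `Ā` of an interval matrix (Neumaier 1990 §3.1, `sup(A)`).
[cite: Neumaier1991, §3.1 (inf A, sup A)] -/
def mboxHi (A : ι → κ → NonemptyInterval ℝ) : ι → κ → ℝ := fun i => boxHi (A i)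

/-- Row `i` of `A̲` is the lower vector of the row box `A i`. [cite: Neumaier1991, §3.1 (inf A, sup A)] -/
@[simp] theorem mboxLo_apply (A : ι → κ → NonemptyInterval ℝ) (i : ι) :
    mboxLo A i = boxLo (A i) :=
  rfl

/-- Row `i` of `Ā` is the upper vector of the row box `A i`. [cite: Neumaier1991, §3.1 (inf A, sup A)] -/
@[simp] theorem mboxHi_apply (A : ι → κ → NonemptyInterval ℝ) (i : ι) :
    mboxHi A i = boxHi (A i) :=
  rfl

/-- `A̲ ≤ Ā`. [cite: Neumaier1991, §3.1 (inf A, sup A)] -/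
theorem mboxLo_le_mboxHi (A : ι → κ → NonemptyInterval ℝ) : mboxLo A ≤ mboxHi A :=
  fun i => boxLo_le_boxHi (A i)

/-- The set of real matrices represented by the interval matrix `A`: the matrix interval
`[A̲, Ā] = {Ã | A̲ ≤ Ã ≤ Ā}` of the entrywise order (Neumaier 1990 §3.1).
[cite: Neumaier1991, §3.1 (A = [inf A, sup A])] -/
def matBoxSet (A : ι → κ → NonemptyInterval ℝ) : Set (ι → κ → ℝ) :=
  Icc (mboxLo A) (mboxHi A)

/-- `Ã ∈ A` iff every row of `Ã` lies in the corresponding row box.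
[cite: Neumaier1991, §3.1 (A = [inf A, sup A])] -/
theorem mem_matBoxSet_iff_rows {A : ι → κ → NonemptyInterval ℝ} {a : ι → κ → ℝ} :
    a ∈ matBoxSet A ↔ ∀ i, a i ∈ boxSet (A i) :=
  ⟨fun h i => ⟨h.1 i, h.2 i⟩, fun h => ⟨fun i => (h i).1, fun i => (h i).2⟩⟩

/-- `Ã ∈ A` iff `Ã_{ik} ∈ A_{ik}` for all entries (Neumaier 1990 §3.1, the definition of an
interval matrix as a set of real matrices). [cite: Neumaier1991, §3.1 (A = [inf A, sup A])] -/
theorem mem_matBoxSet_iff {A : ι → κ → NonemptyInterval ℝ} {a : ι → κ → ℝ} :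
    a ∈ matBoxSet A ↔ ∀ i k, a i k ∈ A i k := by
  rw [mem_matBoxSet_iff_rows]
  exact ⟨fun h i k => mem_boxSet_iff.1 (h i) k, fun h i => mem_boxSet_iff.2 (h i)⟩

/-- Containment of interval matrices (entrywise) is containment of the represented sets.
[cite: Neumaier1991, §3.1 Proposition 3.1.2 (7)] -/
theorem matBoxSet_mono {A A' : ι → κ → NonemptyInterval ℝ} (h : A ≤ A') :
    matBoxSet A ⊆ matBoxSet A' := fun _ ha =>
  mem_matBoxSet_iff_rows.2 fun i => boxSet_mono (h i) (mem_matBoxSet_iff_rows.1 ha i)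

variable [Fintype κ]

/-- The **interval matrix product** `(AB)_{ik} = ∑_j A_{ij} · B_{jk}` (scalar Moore products,
exact interval sums; Neumaier 1990 Proposition 3.1.2 (6)). [cite: Neumaier1991, §3.1 Proposition 3.1.2 (6)] -/
def imatmul (A : ι → κ → NonemptyInterval ℝ) (B : κ → μ → NonemptyInterval ℝ) :
    ι → μ → NonemptyInterval ℝ :=
  fun i l => ∑ k, (A i k).mooreMul (B k l)

/-- **Inclusion property of the interval matrix product**: `Ã ∈ A`, `B̃ ∈ B` (entrywise) ⇒
`(ÃB̃)_{il} = ∑_k Ã_{ik} B̃_{kl} ∈ (AB)_{il}` (Neumaier 1990 §3.1: `AB ⊇ {ÃB̃ | Ã ∈ A, B̃ ∈ B}`,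
Proposition 3.1.2 (6)). [cite: Neumaier1991, §3.1 Proposition 3.1.2 (6)] -/
theorem matmul_mem_imatmul {A : ι → κ → NonemptyInterval ℝ} {B : κ → μ → NonemptyInterval ℝ}
    {a : ι → κ → ℝ} {b : κ → μ → ℝ} (ha : ∀ i k, a i k ∈ A i k) (hb : ∀ k l, b k l ∈ B k l)
    (i : ι) (l : μ) : ∑ k, a i k * b k l ∈ imatmul A B i l :=
  sum_mem_sum fun k _ => mul_mem_mooreMul (ha i k) (hb k l)

/-- **Inclusion isotonicity of the interval matrix product**: `A ⊆ A'`, `B ⊆ B'` ⇒ `AB ⊆ A'B'`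
(Neumaier 1990 Proposition 3.1.2 (7)) — outward rounding of the factors or of the result only
enlarges it. [cite: Neumaier1991, §3.1 Proposition 3.1.2 (7)] -/
theorem imatmul_le_imatmul {A A' : ι → κ → NonemptyInterval ℝ} {B B' : κ → μ → NonemptyInterval ℝ}
    (hA : A ≤ A') (hB : B ≤ B') : imatmul A B ≤ imatmul A' B' :=
  fun i l => sum_le_sum' fun k _ => mooreMul_le_mooreMul (hA i k) (hB k l)

omit [Fintype κ] in
/-- The **matrix interval Taylor polynomial of the `C¹` HOE test**
`hoeMatBox T EV NN K = ∑_{j<K} T^j · EV_j + T^K · NN` (entrywise Moore products and powers, exact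
interval sums; row `i` is the `hoeBox` of `HighOrderEnclosureIntervalTest.lean` of the rows of the
data) — Walawska–Wilczak's `[Ṽ] = ∑_i [0,h]^i ψ^[i](0,[x_k],Id) + [E]`.
[cite: WalawskaWilczak2016, §2.1 (C¹ high-order enclosure)] [cite: Moore1979, §3.5 eq. (3.31)] -/
def hoeMatBox (T : NonemptyInterval ℝ) (EV : ℕ → ι → κ → NonemptyInterval ℝ)
    (NN : ι → κ → NonemptyInterval ℝ) (K : ℕ) : ι → κ → NonemptyInterval ℝ :=
  fun i => hoeBox T (fun j => EV j i) (NN i) K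

omit [Fintype κ] in
/-- **Inclusion property of the matrix HOE box** (Moore 1979 Theorem 3.1 for the interval
polynomial (3.31), entrywise): `t ∈ T`, `Ẽ_j ∈ EV_j` (`j < K`), `Ñ ∈ NN` ⇒
`∑_{j<K} t^j Ẽ_j + t^K Ñ ∈ hoeMatBox T EV NN K`. [cite: Moore1979, §3.3 Theorem 3.1 and §3.5 eq. (3.31)] -/
theorem jacTaylorSum_mem_hoeMatBox {T : NonemptyInterval ℝ} {EV : ℕ → ι → κ → NonemptyInterval ℝ}
    {NN : ι → κ → NonemptyInterval ℝ} {K : ℕ} {t : ℝ} (ht : t ∈ T) {e : ℕ → ι → κ → ℝ}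
    (he : ∀ j < K, e j ∈ matBoxSet (EV j)) {n : ι → κ → ℝ} (hn : n ∈ matBoxSet NN) :
    (∑ j ∈ Finset.range K, t ^ j • e j) + t ^ K • n ∈ matBoxSet (hoeMatBox T EV NN K) := by
  rw [mem_matBoxSet_iff_rows]
  intro i
  have h := taylorSum_mem_hoeBox (E := fun j => EV j i) (V := NN i) (K := K) ht
    (e := fun j => e j i) (fun j hj => mem_matBoxSet_iff_rows.1 (he j hj) i)
    (mem_matBoxSet_iff_rows.1 hn i)
  have hrow : ((∑ j ∈ Finset.range K, t ^ j • e j) + t ^ K • n) i =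
      (∑ j ∈ Finset.range K, t ^ j • e j i) + t ^ K • n i := by
    simp only [Pi.add_apply, Finset.sum_apply, Pi.smul_apply]
  rw [hrow]
  exact h

omit [Fintype κ] in
/-- **Inclusion isotonicity of the matrix HOE box** in all its interval arguments (Moore 1979
§3.2). [cite: Moore1979, §3.2 eqs. (3.4)–(3.5)] -/
theorem hoeMatBox_le_hoeMatBox {T T' : NonemptyInterval ℝ} {EV EV' : ℕ → ι → κ → NonemptyInterval ℝ}
    {NN NN' : ι → κ → NonemptyInterval ℝ} {K : ℕ} (hT : T ≤ T') (hE : ∀ j < K, EV j ≤ EV' j)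
    (hN : NN ≤ NN') : hoeMatBox T EV NN K ≤ hoeMatBox T' EV' NN' K :=
  fun i => hoeBox_le_hoeBox hT (fun j hj => hE j hj i) (hN i)

end IntervalMatrix

/-! ### From the interval tests to the semantic hypotheses of the C¹ step -/

section Semantic

variable {ι : Type*} [Fintype ι] [DecidableEq ι]

/-- The entries of a composition of linear maps of `ℝ^ι` are the matrix product of the entries:
`(A ∘ M) e_j · e_i = ∑_k (A e_k)_i (M e_j)_k` (`LinearMap.toMatrix'_comp`). [folklore] -/
private theorem comp_apply_single (A M : (ι → ℝ) →L[ℝ] (ι → ℝ)) (i j : ι) :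
    (A.comp M) (Pi.single j 1) i = ∑ k, A (Pi.single k 1) i * M (Pi.single j 1) k := by
  have h := congrFun (congrFun (LinearMap.toMatrix'_comp (A : (ι → ℝ) →ₗ[ℝ] (ι → ℝ))
    (M : (ι → ℝ) →ₗ[ℝ] (ι → ℝ))) i) j
  simpa [Matrix.mul_apply, LinearMap.toMatrix'_apply] using h

omit [Fintype ι] in
/-- The entries of the Jacobian Taylor sum `∑_{k<K} t^k Φ_k' + t^K N` are the Taylor sums of the
entries. [folklore] -/
private theorem taylorSum_apply_single (Φ' : ℕ → (ι → ℝ) →L[ℝ] (ι → ℝ))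
    (N : (ι → ℝ) →L[ℝ] (ι → ℝ)) (K : ℕ) (t : ℝ) :
    (fun i j => ((∑ k ∈ Finset.range K, t ^ k • Φ' k) + t ^ K • N) (Pi.single j 1) i) =
      (∑ k ∈ Finset.range K, t ^ k • fun i j => Φ' k (Pi.single j 1) i) +
        t ^ K • fun i j => N (Pi.single j 1) i := by
  ext i j
  simp only [_root_.add_apply, _root_.sum_apply, _root_.smul_apply, Finset.sum_apply,
    Pi.smul_apply, Pi.add_apply, smul_eq_mul]

/-- **The interval product test implies `hKN`.**  If the interval matrix `AK` contains the
Jacobian `Φ_K'(z)` for every `z ∈ S` and `NN ⊇ AK · Ṽ` (interval matrix product), then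
`Φ_K'(z) ∘ M ∈ NN` for all `z ∈ S` and all real matrices `M ∈ Ṽ` — hypothesis `hKN` of
`variationalEnclosure_step`, i.e. Walawska–Wilczak's `ψ^[m+1](0,[ỹ],Id)[Ṽ] ⊂ [E]` read through
Neumaier's `{ÃB̃} ⊆ AB`. [cite: WalawskaWilczak2016, §2.1 (C¹ high-order enclosure)]
[cite: Neumaier1991, §3.1 Proposition 3.1.2 (6)–(7)] -/
theorem hKN_of_imatmul {Φ'K : (ι → ℝ) → (ι → ℝ) →L[ℝ] (ι → ℝ)} {S : Set (ι → ℝ)}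
    {AK VV NN : ι → ι → NonemptyInterval ℝ}
    (hAK : ∀ z ∈ S, ∀ i l, Φ'K z (Pi.single l 1) i ∈ AK i l) (hNN : imatmul AK VV ≤ NN) :
    ∀ z ∈ S, ∀ M : (ι → ℝ) →L[ℝ] (ι → ℝ),
      (fun i j => M (Pi.single j 1) i) ∈ Icc (mboxLo VV) (mboxHi VV) →
      (fun i j => (Φ'K z).comp M (Pi.single j 1) i) ∈ Icc (mboxLo NN) (mboxHi NN) := by
  intro z hz M hM
  have hM' : ∀ k l, M (Pi.single l 1) k ∈ VV k l := fun k l =>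
    (mem_matBoxSet_iff (A := VV)).1 hM k l
  refine matBoxSet_mono hNN ((mem_matBoxSet_iff (A := imatmul AK VV)).2 fun i l => ?_)
  rw [comp_apply_single]
  exact matmul_mem_imatmul (a := fun i k => Φ'K z (Pi.single k 1) i)
    (b := fun k l => M (Pi.single l 1) k) (hAK z hz) hM' i l

omit [Fintype ι] in
/-- **The matrix HOE test implies `hinclV`.**  If `[0, h] ⊆ T`, the interval matrices `EV_j`
contain `Φ_j'(x)` for `x ∈ W` (`j < K`), and `∑_{j<K} T^j · EV_j + T^K · NN ⊆ Ṽ`, then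
`∑_{j<K} t^j Φ_j'(x) + t^K N ∈ Ṽ` for all `x ∈ W`, `t ∈ [0, h]`, `N ∈ NN` — hypothesis `hinclV` of
`variationalEnclosure_step` (Walawska–Wilczak 2016 §2.1, the definition of `[Ṽ]`).
[cite: WalawskaWilczak2016, §2.1 (C¹ high-order enclosure)] [cite: Moore1979, §3.5 eq. (3.31)] -/
theorem hinclV_of_hoeMatBox {Φ' : ℕ → (ι → ℝ) → (ι → ℝ) →L[ℝ] (ι → ℝ)} {K : ℕ} {h : ℝ}
    {T : NonemptyInterval ℝ} (hT : ∀ t ∈ Icc 0 h, t ∈ T) {W : Set (ι → ℝ)}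
    {EV : ℕ → ι → ι → NonemptyInterval ℝ} {NN VV : ι → ι → NonemptyInterval ℝ}
    (hEV : ∀ j < K, ∀ x ∈ W, ∀ i l, Φ' j x (Pi.single l 1) i ∈ EV j i l)
    (htestV : hoeMatBox T EV NN K ≤ VV) :
    ∀ x ∈ W, ∀ t ∈ Icc 0 h, ∀ N : (ι → ℝ) →L[ℝ] (ι → ℝ),
      (fun i j => N (Pi.single j 1) i) ∈ Icc (mboxLo NN) (mboxHi NN) →
      (fun i j => ((∑ k ∈ Finset.range K, t ^ k • Φ' k x) + t ^ K • N) (Pi.single j 1) i) ∈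
        Icc (mboxLo VV) (mboxHi VV) := by
  intro x hx t ht N hN
  rw [taylorSum_apply_single]
  exact matBoxSet_mono htestV (jacTaylorSum_mem_hoeMatBox (hT t ht)
    (fun j hj => (mem_matBoxSet_iff (A := EV j)).2 fun i l => hEV j hj x hx i l) hN)

omit [Fintype ι] [DecidableEq ι] in
/-- A box all of whose component intervals are non-degenerate has non-empty interior, hence is a
set of unique differentiability (so derivatives WITHIN it, e.g. of the flow map on the box of
initial conditions, are unique). [cite: Neumaier1991, §3.1 (int A)] -/
theorem uniqueDiffOn_boxSet [Finite ι] {B : ι → NonemptyInterval ℝ} (hB : ∀ i, (B i).fst < (B i).snd) :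
    UniqueDiffOn ℝ (boxSet B) := by
  refine uniqueDiffOn_convex (convex_boxSet B) ⟨fun i => ((B i).fst + (B i).snd) / 2, ?_⟩
  have hsub : Set.pi univ (fun i => Ioo (boxLo B i) (boxHi B i)) ⊆ boxSet B := by
    rw [boxSet, ← Set.pi_univ_Icc]
    exact Set.pi_mono fun i _ => Ioo_subset_Icc_self
  refine interior_mono hsub ?_
  rw [interior_pi_set finite_univ]
  simp only [interior_Ioo, mem_univ_pi, mem_Ioo, boxLo_apply, boxHi_apply]
  intro i
  constructor <;> linarith [hB i]

end Semantic

/-! ### The C¹ HOE step from box data, smooth field on an open domain -/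

section Step

variable {ι : Type*} [Fintype ι] [DecidableEq ι] {Ω : Opens (ι → ℝ)} {f : (ι → ℝ) → ι → ℝ}
  (hf : ContDiffOn ℝ ∞ f (Ω : Set (ι → ℝ)))

/-- **`C¹` high-order enclosure step from box data, field smooth on an open set**
(Walawska–Wilczak 2016 §2.1 / §2.2 Lemma 2; Zgliczyński 2002; interval matrices after
Neumaier 1990 §3.1).  Let `f ∈ C^∞(Ω; ℝ^ι)`, `K ≥ 1`, `h ≥ 0`, `T ⊇ [0, h]`; boxes `W` (initial
conditions), `S` with `boxSet S ⊆ Ω` (a-priori enclosure), `V ⊇ Φ_K(S)`, `E_j ⊇ Φ_j(W)` (`j < K`)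
with the state HOE containment `∑_{j<K} T^j · E_j + T^K · V ⊆ S`; interval matrices
`EV_j ∋ Φ_j'(x)` for `x ∈ W` (`j < K`), `AK ∋ Φ_K'(z)` for `z ∈ S` (sound enclosures of the
Jacobians `Φ_j' = smoothTaylorFDeriv hf j`, by any means), `Ṽ = VV`, `NN ⊇ AK · VV` and the `C¹`
containment `∑_{j<K} T^j · EV_j + T^K · NN ⊆ VV`.  Then for every `x ∈ W` the variational system
`y' = f(y)`, `V' = Df(y) ∘ V`, `y 0 = x`, `V 0 = Id` has a solution on `[0, h]`, and EVERY solution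
pair `(z, J)` satisfies, for all `t ∈ [0, h]`: `z t ∈ S`, `z t = ∑_{j<K} t^j Φ_j(x) + t^K v` with
`v ∈ V`, `J t ∈ VV` and `J t = ∑_{j<K} t^j Φ_j'(x) + t^K N` with `N ∈ NN` (entries
`(J t e_l)_i`).  All analytic, growth and set-level hypotheses of `variationalEnclosure_step` are
discharged: only box data remain. [cite: WalawskaWilczak2016, §2.1 (C¹ high-order enclosure) and §2.2 Lemma 2]
[cite: Neumaier1991, §3.1 Proposition 3.1.2 (6)–(7)] [cite: Moore1979, §8.1 eq. (8.10)] -/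
theorem variationalEnclosure_step_intervalTest_smoothOn_local {K : ℕ} (hK : 0 < K) {h : ℝ}
    (hh : 0 ≤ h) {T : NonemptyInterval ℝ} (hT : ∀ t ∈ Icc 0 h, t ∈ T)
    (W S V : ι → NonemptyInterval ℝ) (E : ℕ → ι → NonemptyInterval ℝ)
    (EV : ℕ → ι → ι → NonemptyInterval ℝ) (AK VV NN : ι → ι → NonemptyInterval ℝ)
    (hSΩ : boxSet S ⊆ Ω)
    (hE : ∀ j < K, MapsTo (smoothTaylorMap hf j) (boxSet W) (boxSet (E j)))
    (hV : MapsTo (smoothTaylorMap hf K) (boxSet S) (boxSet V)) (htest : hoeBox T E V K ≤ S)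
    (hEV : ∀ j < K, ∀ x ∈ boxSet W, ∀ i l, smoothTaylorFDeriv hf j x (Pi.single l 1) i ∈ EV j i l)
    (hAK : ∀ z ∈ boxSet S, ∀ i l, smoothTaylorFDeriv hf K z (Pi.single l 1) i ∈ AK i l)
    (hNN : imatmul AK VV ≤ NN) (htestV : hoeMatBox T EV NN K ≤ VV)
    {x : ι → ℝ} (hx : x ∈ boxSet W) :
    (∃ y : ℝ → ι → ℝ, ∃ V' : ℝ → (ι → ℝ) →L[ℝ] (ι → ℝ), y 0 = x ∧ V' 0 = 1 ∧
      (∀ t ∈ Icc 0 h, HasDerivWithinAt y (f (y t)) (Icc 0 h) t) ∧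
      ∀ t ∈ Icc 0 h, HasDerivWithinAt V' ((fderiv ℝ f (y t)).comp (V' t)) (Icc 0 h) t) ∧
    ∀ (z : ℝ → ι → ℝ) (J : ℝ → (ι → ℝ) →L[ℝ] (ι → ℝ)), z 0 = x → J 0 = 1 →
      (∀ t ∈ Icc 0 h, HasDerivWithinAt z (f (z t)) (Icc 0 h) t) →
      (∀ t ∈ Icc 0 h, HasDerivWithinAt J ((fderiv ℝ f (z t)).comp (J t)) (Icc 0 h) t) →
      ∀ t ∈ Icc 0 h,
        (z t ∈ boxSet S ∧ ∃ v ∈ boxSet V,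
          z t = (∑ j ∈ Finset.range K, t ^ j • smoothTaylorMap hf j x) + t ^ K • v) ∧
        (∀ i l, J t (Pi.single l 1) i ∈ VV i l) ∧
        ∃ N : (ι → ℝ) →L[ℝ] (ι → ℝ), (∀ i l, N (Pi.single l 1) i ∈ NN i l) ∧
          J t = (∑ j ∈ Finset.range K, t ^ j • smoothTaylorFDeriv hf j x) + t ^ K • N := by
  obtain ⟨hex, huniq⟩ := variationalEnclosure_step_smoothOn_local hf hK (W := boxSet W) hSΩ
    (isCompact_boxSet S) (convex_boxSet S) (boxLo_le_boxHi V) hV (mboxLo_le_mboxHi NN)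
    (hKN_of_imatmul hAK hNN) hh (hincl_of_hoeBox hT hE htest) (hinclV_of_hoeMatBox hT hEV htestV)
    hx
  refine ⟨hex, fun z J hz0 hJ0 hz hJ t ht => ?_⟩
  obtain ⟨hzenc, hJenc, N, hN, hJt⟩ := huniq z J hz0 hJ0 hz hJ t ht
  exact ⟨hzenc, (mem_matBoxSet_iff (A := VV)).1 hJenc, N, (mem_matBoxSet_iff (A := NN)).1 hN, hJt⟩

/-- **The Jacobian tube over the step** (the matrix analogue of Moore 1979 (8.10)): under the
hypotheses of `variationalEnclosure_step_intervalTest_smoothOn_local`, every solution pair from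
`(x, Id)`, `x ∈ W`, satisfies `J t ∈ ∑_{j<K} T^j · EV_j + T^K · NN` (entrywise) for all
`t ∈ [0, h]`. [cite: WalawskaWilczak2016, §2.1 (C¹ high-order enclosure)] [cite: Moore1979, §8.1 eq. (8.10)] -/
theorem variationalEnclosure_jacobian_tube_smoothOn_local {K : ℕ} (hK : 0 < K) {h : ℝ}
    (hh : 0 ≤ h) {T : NonemptyInterval ℝ} (hT : ∀ t ∈ Icc 0 h, t ∈ T)
    (W S V : ι → NonemptyInterval ℝ) (E : ℕ → ι → NonemptyInterval ℝ)
    (EV : ℕ → ι → ι → NonemptyInterval ℝ) (AK VV NN : ι → ι → NonemptyInterval ℝ)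
    (hSΩ : boxSet S ⊆ Ω)
    (hE : ∀ j < K, MapsTo (smoothTaylorMap hf j) (boxSet W) (boxSet (E j)))
    (hV : MapsTo (smoothTaylorMap hf K) (boxSet S) (boxSet V)) (htest : hoeBox T E V K ≤ S)
    (hEV : ∀ j < K, ∀ x ∈ boxSet W, ∀ i l, smoothTaylorFDeriv hf j x (Pi.single l 1) i ∈ EV j i l)
    (hAK : ∀ z ∈ boxSet S, ∀ i l, smoothTaylorFDeriv hf K z (Pi.single l 1) i ∈ AK i l)
    (hNN : imatmul AK VV ≤ NN) (htestV : hoeMatBox T EV NN K ≤ VV)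
    {x : ι → ℝ} (hx : x ∈ boxSet W) {z : ℝ → ι → ℝ} {J : ℝ → (ι → ℝ) →L[ℝ] (ι → ℝ)}
    (hz0 : z 0 = x) (hJ0 : J 0 = 1) (hz : ∀ t ∈ Icc 0 h, HasDerivWithinAt z (f (z t)) (Icc 0 h) t)
    (hJ : ∀ t ∈ Icc 0 h, HasDerivWithinAt J ((fderiv ℝ f (z t)).comp (J t)) (Icc 0 h) t)
    {t : ℝ} (ht : t ∈ Icc 0 h) :
    ∀ i l, J t (Pi.single l 1) i ∈ hoeMatBox T EV NN K i l := by
  obtain ⟨-, huniq⟩ := variationalEnclosure_step_intervalTest_smoothOn_local hf hK hh hT W S V E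
    EV AK VV NN hSΩ hE hV htest hEV hAK hNN htestV hx
  obtain ⟨-, -, N, hN, hJt⟩ := huniq z J hz0 hJ0 hz hJ t ht
  have hmem := jacTaylorSum_mem_hoeMatBox (EV := EV) (NN := NN) (K := K) (hT t ht)
    (e := fun j => fun i l => smoothTaylorFDeriv hf j x (Pi.single l 1) i)
    (fun j hj => (mem_matBoxSet_iff (A := EV j)).2 fun i l => hEV j hj x hx i l)
    ((mem_matBoxSet_iff (A := NN)).2 hN)
  rw [← taylorSum_apply_single, ← hJt] at hmem
  exact (mem_matBoxSet_iff (A := hoeMatBox T EV NN K)).1 hmem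

/-- **The `C¹` enclosure from box data bounds the derivative of the flow** (Zgliczyński 2002;
Walawska–Wilczak 2016 §1.1: `ψ(t, x, Id) = D_xφ(t, x)`, §2.2 Lemma 2).  Under the box-data
hypotheses of `variationalEnclosure_step_intervalTest_smoothOn_local`, with `boxSet S` a set of
unique differentiability (e.g. `uniqueDiffOn_boxSet`), for ANY family `u` of solutions of
`y' = f(y)` on `[0, h]` from the points of `W` staying in `S`, every `x ∈ W`, `τ ∈ [0, h]` and any
interval `T' ∋ τ`: the flow map `x' ↦ u x' τ` has a derivative `J` at `x` within `boxSet W` whose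
entries lie in `VV` and in `∑_{j<K} T'^j · EV_j + T'^K · NN` — for `T' = [h, h]` this is the
interval matrix `J1 ∋ Dφ_h(x)` that a `C¹`-Lohner step passes to its rearrangement stage.
[cite: WalawskaWilczak2016, §1.1 (ψ = D_xφ·V) and §2.2 Lemma 2]
[cite: Neumaier1991, §3.1 Proposition 3.1.2 (6)–(7)] -/
theorem hasFDerivWithinAt_flow_intervalTest_smoothOn_local {K : ℕ} (hK : 0 < K) {h : ℝ}
    (hh : 0 ≤ h) {T : NonemptyInterval ℝ} (hT : ∀ t ∈ Icc 0 h, t ∈ T)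
    (W S V : ι → NonemptyInterval ℝ) (E : ℕ → ι → NonemptyInterval ℝ)
    (EV : ℕ → ι → ι → NonemptyInterval ℝ) (AK VV NN : ι → ι → NonemptyInterval ℝ)
    (hSΩ : boxSet S ⊆ Ω) (hSu : UniqueDiffOn ℝ (boxSet S))
    (hE : ∀ j < K, MapsTo (smoothTaylorMap hf j) (boxSet W) (boxSet (E j)))
    (hV : MapsTo (smoothTaylorMap hf K) (boxSet S) (boxSet V)) (htest : hoeBox T E V K ≤ S)
    (hEV : ∀ j < K, ∀ x ∈ boxSet W, ∀ i l, smoothTaylorFDeriv hf j x (Pi.single l 1) i ∈ EV j i l)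
    (hAK : ∀ z ∈ boxSet S, ∀ i l, smoothTaylorFDeriv hf K z (Pi.single l 1) i ∈ AK i l)
    (hNN : imatmul AK VV ≤ NN) (htestV : hoeMatBox T EV NN K ≤ VV)
    {u : (ι → ℝ) → ℝ → ι → ℝ} (hu : IsSolutionFamily f (boxSet S) (boxSet W) h u)
    {x : ι → ℝ} (hx : x ∈ boxSet W) {τ : ℝ} (hτ : τ ∈ Icc 0 h) {T' : NonemptyInterval ℝ}
    (hτT' : τ ∈ T') :
    ∃ J : (ι → ℝ) →L[ℝ] (ι → ℝ), HasFDerivWithinAt (fun x' => u x' τ) J (boxSet W) x ∧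
      (∀ i l, J (Pi.single l 1) i ∈ VV i l) ∧
      (∀ i l, J (Pi.single l 1) i ∈ hoeMatBox T' EV NN K i l) ∧
      ∃ N : (ι → ℝ) →L[ℝ] (ι → ℝ), (∀ i l, N (Pi.single l 1) i ∈ NN i l) ∧
        J = (∑ j ∈ Finset.range K, τ ^ j • smoothTaylorFDeriv hf j x) + τ ^ K • N := by
  obtain ⟨J, hJ, hJenc, N, hN, hJt⟩ :=
    hasFDerivWithinAt_flow_of_variationalEnclosure_smoothOn_local hf hK (W := boxSet W) hSΩ
      (isCompact_boxSet S) (convex_boxSet S) hSu (boxLo_le_boxHi V) hV (mboxLo_le_mboxHi NN)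
      (hKN_of_imatmul hAK hNN) hh (hincl_of_hoeBox hT hE htest)
      (hinclV_of_hoeMatBox hT hEV htestV) hu hx hτ
  have hN' : ∀ i l, N (Pi.single l 1) i ∈ NN i l := (mem_matBoxSet_iff (A := NN)).1 hN
  have hmem := jacTaylorSum_mem_hoeMatBox (EV := EV) (NN := NN) (K := K) hτT'
    (e := fun j => fun i l => smoothTaylorFDeriv hf j x (Pi.single l 1) i)
    (fun j hj => (mem_matBoxSet_iff (A := EV j)).2 fun i l => hEV j hj x hx i l)
    ((mem_matBoxSet_iff (A := NN)).2 hN')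
  rw [← taylorSum_apply_single, ← hJt] at hmem
  exact ⟨J, hJ, (mem_matBoxSet_iff (A := VV)).1 hJenc,
    (mem_matBoxSet_iff (A := hoeMatBox T' EV NN K)).1 hmem, N, hN', hJt⟩

end Step

end Literature.Analysis.ODE

end
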